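import Mathlib.Analysis.MeanInequalities
import Mathlib.Analysis.Complex.ExponentialBounds
import Literature.Barriers.MatrixMultiplication.UniversalMethodBarrierCwCore
import HarnessLib

/-!
# Certifying bases for `g_q`: the tangent (Gibbs) bound and Taylor certificates for logarithms — proved

Topic `Literature/Barriers/MatrixMultiplication`; part of the PROOF of `UniversalMethodBarrier`
(Alman 2021), milestone "Thm. 1.3". Alman's numbers (§4.1 table: `S̃(CW_q) = 2.7551…`, bounds
`2.16805…, …`) come from "optimization software"; here the supremum of the concave function
`log g_q(v)` (`cwBase`) over `[0, 1/3]` is certified by a tangent line: by weighted AM–GM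
(Gibbs' inequality), for any positive `r₀ + r₁ + r₂ ≤ 1`,
`g_q(v) ≤ (1/r₀)^{1/3+v} (q/r₁)^{2/3-2v} (1/r₂)^v`, the exponential of an affine function of
`v`, hence `≤ max` of its endpoint values `e^{T₀}, e^{T_{1/3}}` (`T₀ = (1/3)log(1/r₀)+(2/3)log(q/r₁)`,
`T_{1/3} = (2/3)log(1/r₀)+(1/3)log(1/r₂)`). Logarithms of rationals are then bounded by Taylor
polynomials of `exp` (`Real.sum_le_exp_of_nonneg`, `Real.exp_bound'`) after splitting off powers of
`2` (`Real.log_two_lt_d9/gt_d9`). Everything PROVED; the per-`q` certificates are in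
`UniversalMethodBarrierCwNumerics.lean`.

## Content

* `cwBase_le_tangent` (Gibbs bound), `tangent_le_max`,
  `le_universalOmega_bigCwTensor_of_tangent` — **from `T₀, T_{1/3} ≤ (2/c₀) log(q+2)`
  (`0 < c₀ ≤ 3`) to `c₀ ≤ ω_u(CW_q)`**.
* `log_le_of_le_taylor` (`y ≤ Σ_{i<n} Uⁱ/i! ⇒ log y ≤ U`), `le_log_of_taylor_le`
  (`Σ_{i<n} Lⁱ/i! + Lⁿ(n+1)/(n!n) ≤ y ⇒ L ≤ log y`, `0 ≤ L ≤ 1`), `log_eq_mul_log_two_add`.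

## References

* J. Alman, Theory of Computing 17 (2021), §4.1 and App. A. [Alman2021]
-/

noncomputable section

open scoped BigOperators

namespace Literature.Barriers.MatrixMultiplication

open Literature.Computability.AlgebraicComplexity

universe u

/-! ## The tangent bound `g_q(v) ≤ Π_k (c_k/r_k)^{π_k(v)}` (Gibbs' inequality / weighted AM–GM) -/

section Tangent

/-- **Gibbs / tangent-line bound for `g_q`**: for positive `r₀, r₁, r₂` with `r₀ + r₁ + r₂ ≤ 1` and
`v ∈ [0, 1/3]`, `g_q(v) ≤ (1/r₀)^{1/3+v} (q/r₁)^{2/3-2v} (1/r₂)^v` (the right-hand side is the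
exponential of the tangent line to the concave `log g_q` at the point whose class distribution is
`r`; weighted AM–GM `Π (r_k/π_k)^{π_k} ≤ Σ π_k (r_k/π_k) ≤ 1`). This is how Alman's
`sup_v g_q(v)` (§4.1, "computed using optimization software") is certified here. [cite: Alman2021, §4.1] -/
theorem cwBase_le_tangent (q : ℕ) {r₀ r₁ r₂ : ℝ} (hr₀ : 0 < r₀) (hr₁ : 0 < r₁) (hr₂ : 0 < r₂)
    (hsum : r₀ + r₁ + r₂ ≤ 1) {v : ℝ} (hv : v ∈ Set.Icc (0 : ℝ) (1 / 3)) :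
    cwBase q v ≤ (1 / r₀) ^ (1 / 3 + v) * ((q : ℝ) / r₁) ^ (2 / 3 - 2 * v) * (1 / r₂) ^ v := by
  have hπ0 : 0 ≤ 1 / 3 + v := by linarith [hv.1]
  have hπ1 : 0 ≤ 2 / 3 - 2 * v := by linarith [hv.2]
  have hπ2 : 0 ≤ v := hv.1
  -- split each factor `(c/π)^π = (c/r)^π (r/π)^π`
  have split : ∀ (c r π : ℝ), 0 ≤ c → 0 < r → 0 ≤ π →
      (c / π) ^ π = (c / r) ^ π * (r / π) ^ π := by
    intro c r π hc hr hπ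
    rw [← Real.mul_rpow (div_nonneg hc hr.le) (div_nonneg hr.le hπ)]
    congr 1
    rcases hπ.eq_or_lt with h0 | hpos
    · rw [← h0]; simp
    · field_simp
  unfold cwBase
  rw [split 1 r₀ _ zero_le_one hr₀ hπ0, split (q : ℝ) r₁ _ (Nat.cast_nonneg _) hr₁ hπ1,
    split 1 r₂ _ zero_le_one hr₂ hπ2]
  -- weighted AM–GM on the second factors
  have hamgm : (r₀ / (1 / 3 + v)) ^ (1 / 3 + v) * (r₁ / (2 / 3 - 2 * v)) ^ (2 / 3 - 2 * v) *
      (r₂ / v) ^ v ≤ 1 := by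
    refine (Real.geom_mean_le_arith_mean3_weighted hπ0 hπ1 hπ2 (div_nonneg hr₀.le hπ0)
      (div_nonneg hr₁.le hπ1) (div_nonneg hr₂.le hπ2) (by ring)).trans ?_
    have t0 : (1 / 3 + v) * (r₀ / (1 / 3 + v)) ≤ r₀ := by
      rcases hπ0.eq_or_lt with h0 | hpos
      · rw [← h0]; simp [hr₀.le]
      · rw [mul_div_cancel₀ _ hpos.ne']
    have t1 : (2 / 3 - 2 * v) * (r₁ / (2 / 3 - 2 * v)) ≤ r₁ := by
      rcases hπ1.eq_or_lt with h0 | hpos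
      · rw [← h0]; simp [hr₁.le]
      · rw [mul_div_cancel₀ _ hpos.ne']
    have t2 : v * (r₂ / v) ≤ r₂ := by
      rcases hπ2.eq_or_lt with h0 | hpos
      · rw [← h0]; simp [hr₂.le]
      · rw [mul_div_cancel₀ _ hpos.ne']
    linarith
  have hA : 0 ≤ (1 / r₀) ^ (1 / 3 + v) * ((q : ℝ) / r₁) ^ (2 / 3 - 2 * v) * (1 / r₂) ^ v := by
    positivity
  calc (1 / r₀) ^ (1 / 3 + v) * (r₀ / (1 / 3 + v)) ^ (1 / 3 + v) *
        (((q : ℝ) / r₁) ^ (2 / 3 - 2 * v) * (r₁ / (2 / 3 - 2 * v)) ^ (2 / 3 - 2 * v)) *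
        ((1 / r₂) ^ v * (r₂ / v) ^ v)
      = ((1 / r₀) ^ (1 / 3 + v) * ((q : ℝ) / r₁) ^ (2 / 3 - 2 * v) * (1 / r₂) ^ v) *
          ((r₀ / (1 / 3 + v)) ^ (1 / 3 + v) * (r₁ / (2 / 3 - 2 * v)) ^ (2 / 3 - 2 * v) *
            (r₂ / v) ^ v) := by ring
    _ ≤ ((1 / r₀) ^ (1 / 3 + v) * ((q : ℝ) / r₁) ^ (2 / 3 - 2 * v) * (1 / r₂) ^ v) * 1 :=
        mul_le_mul_of_nonneg_left hamgm hA
    _ = _ := mul_one _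

/-- The tangent bound is the exponential of an affine function of `v`, hence on `[0, 1/3]` at
most the larger of its endpoint values: with `T₀ = (1/3) log(1/r₀) + (2/3) log(q/r₁)` and
`T_{1/3} = (2/3) log(1/r₀) + (1/3) log(1/r₂)`,
`(1/r₀)^{1/3+v} (q/r₁)^{2/3-2v} (1/r₂)^v ≤ max(e^{T₀}, e^{T_{1/3}})`. [cite: Alman2021, §4.1] -/
theorem tangent_le_max (q : ℕ) (hq : 0 < q) {r₀ r₁ r₂ : ℝ} (hr₀ : 0 < r₀) (hr₁ : 0 < r₁)
    (hr₂ : 0 < r₂) {v : ℝ} (hv : v ∈ Set.Icc (0 : ℝ) (1 / 3)) :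
    (1 / r₀) ^ (1 / 3 + v) * ((q : ℝ) / r₁) ^ (2 / 3 - 2 * v) * (1 / r₂) ^ v ≤
      max (Real.exp ((1 / 3) * Real.log (1 / r₀) + (2 / 3) * Real.log ((q : ℝ) / r₁)))
        (Real.exp ((2 / 3) * Real.log (1 / r₀) + (1 / 3) * Real.log (1 / r₂))) := by
  have hq0 : (0 : ℝ) < q := by exact_mod_cast hq
  have hx0 : 0 < 1 / r₀ := by positivity
  have hx1 : 0 < (q : ℝ) / r₁ := by positivity
  have hx2 : 0 < 1 / r₂ := by positivity
  rw [Real.rpow_def_of_pos hx0, Real.rpow_def_of_pos hx1, Real.rpow_def_of_pos hx2,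
    ← Real.exp_add, ← Real.exp_add]
  set a := Real.log (1 / r₀)
  set b := Real.log ((q : ℝ) / r₁)
  set c := Real.log (1 / r₂)
  -- affine in `v`: value = (1 - 3v) T₀ + 3v T_{1/3}
  have key : a * (1 / 3 + v) + b * (2 / 3 - 2 * v) + c * v =
      (1 - 3 * v) * ((1 / 3) * a + (2 / 3) * b) + (3 * v) * ((2 / 3) * a + (1 / 3) * c) := by ring
  rw [key]
  have h1 : 0 ≤ 1 - 3 * v := by linarith [hv.2]
  have h2 : 0 ≤ 3 * v := by linarith [hv.1]
  rcases le_total ((1 / 3) * a + (2 / 3) * b) ((2 / 3) * a + (1 / 3) * c) with hle | hle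
  · refine le_trans (Real.exp_le_exp.2 ?_) (le_max_right _ _)
    nlinarith
  · refine le_trans (Real.exp_le_exp.2 ?_) (le_max_left _ _)
    nlinarith

/-- **From a tangent certificate to a bound on `ω_u(CW_q)`**: if `r₀, r₁, r₂ > 0`,
`r₀ + r₁ + r₂ ≤ 1`, `0 < c₀ ≤ 3` and both endpoint values satisfy
`T₀, T_{1/3} ≤ (2/c₀) log(q+2)`, then `c₀ ≤ ω_u(CW_q)` (via `min_le_universalOmega_bigCwTensor`
with `B = max(e^{T₀}, e^{T_{1/3}})`). [cite: Alman2021, Thm. 1.3 (proof, §4.1)] -/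
theorem le_universalOmega_bigCwTensor_of_tangent (K : Type) [Field K] (q : ℕ) (hq : 0 < q)
    {r₀ r₁ r₂ : ℝ} (hr₀ : 0 < r₀) (hr₁ : 0 < r₁) (hr₂ : 0 < r₂) (hsum : r₀ + r₁ + r₂ ≤ 1)
    {c₀ : ℝ} (hc₀ : 0 < c₀) (hc₃ : c₀ ≤ 3)
    (hT₀ : (1 / 3) * Real.log (1 / r₀) + (2 / 3) * Real.log ((q : ℝ) / r₁) ≤
      2 / c₀ * Real.log ((q : ℝ) + 2))
    (hT₁ : (2 / 3) * Real.log (1 / r₀) + (1 / 3) * Real.log (1 / r₂) ≤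
      2 / c₀ * Real.log ((q : ℝ) + 2)) :
    c₀ ≤ universalOmega K (bigCwTensor K q) := by
  set T₀ := (1 / 3) * Real.log (1 / r₀) + (2 / 3) * Real.log ((q : ℝ) / r₁) with hT0
  set T₁ := (2 / 3) * Real.log (1 / r₀) + (1 / 3) * Real.log (1 / r₂) with hT1
  set B := max (Real.exp T₀) (Real.exp T₁) with hBdef
  -- `T₁ > 0`, so `B > 1`
  have hr₀1 : r₀ < 1 := by linarith
  have hr₂1 : r₂ < 1 := by linarith
  have hlog₀ : 0 < Real.log (1 / r₀) := Real.log_pos (by rw [lt_div_iff₀ hr₀]; linarith)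
  have hlog₂ : 0 < Real.log (1 / r₂) := Real.log_pos (by rw [lt_div_iff₀ hr₂]; linarith)
  have hT₁pos : 0 < T₁ := by rw [hT1]; positivity
  have hB1 : 1 < B := lt_of_lt_of_le (by rw [← Real.exp_zero]; exact Real.exp_lt_exp.2 hT₁pos)
    (le_max_right _ _)
  have hB : ∀ v ∈ Set.Icc (0 : ℝ) (1 / 3), cwBase q v ≤ B := fun v hv =>
    (cwBase_le_tangent q hr₀ hr₁ hr₂ hsum hv).trans (tangent_le_max q hq hr₀ hr₁ hr₂ hv)
  have hmain := min_le_universalOmega_bigCwTensor K q B hB1 hB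
  refine le_trans ?_ hmain
  refine le_min hc₃ ?_
  -- `log B = max(T₀, T₁) ≤ (2/c₀) log(q+2)`
  have hlogB : Real.log B ≤ 2 / c₀ * Real.log ((q : ℝ) + 2) := by
    rw [hBdef]
    rcases le_total (Real.exp T₀) (Real.exp T₁) with h | h
    · rw [max_eq_right h, Real.log_exp]; exact hT₁
    · rw [max_eq_left h, Real.log_exp]; exact hT₀
  have hlogBpos : 0 < Real.log B := Real.log_pos hB1
  rw [le_div_iff₀ hlogBpos]
  calc c₀ * Real.log B ≤ c₀ * (2 / c₀ * Real.log ((q : ℝ) + 2)) :=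
        mul_le_mul_of_nonneg_left hlogB hc₀.le
    _ = 2 * Real.log ((q : ℝ) + 2) := by field_simp

end Tangent

/-! ## Certified logarithm bounds via Taylor polynomials of `exp` -/

section LogCert

/-- `log y ≤ U` whenever `y ≤ Σ_{i<n} Uⁱ/i!` (`U ≥ 0`, the partial sums under-estimate `e^U`).
[folklore] -/
theorem log_le_of_le_taylor {y U : ℝ} (hy : 0 < y) (hU : 0 ≤ U) (n : ℕ)
    (h : y ≤ ∑ i ∈ Finset.range n, U ^ i / i.factorial) : Real.log y ≤ U := by
  have h1 : y ≤ Real.exp U := h.trans (Real.sum_le_exp_of_nonneg hU n)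
  calc Real.log y ≤ Real.log (Real.exp U) := Real.log_le_log hy h1
    _ = U := Real.log_exp U

/-- `L ≤ log y` whenever `Σ_{i<n} Lⁱ/i! + Lⁿ(n+1)/(n!·n) ≤ y` (`0 ≤ L ≤ 1`, `n ≥ 1`; the
right-hand side over-estimates `e^L`, `Real.exp_bound'`). [folklore] -/
theorem le_log_of_taylor_le {y L : ℝ} (hL0 : 0 ≤ L) (hL1 : L ≤ 1) {n : ℕ} (hn : 0 < n)
    (h : (∑ i ∈ Finset.range n, L ^ i / i.factorial) + L ^ n * (n + 1) / (n.factorial * n) ≤ y) :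
    L ≤ Real.log y := by
  have h1 : Real.exp L ≤ y := (Real.exp_bound' hL0 hL1 hn).trans h
  calc L = Real.log (Real.exp L) := (Real.log_exp L).symm
    _ ≤ Real.log y := Real.log_le_log (Real.exp_pos L) h1

/-- Splitting off powers of two: `log y = k log 2 + log (y / 2^k)`. [folklore] -/
theorem log_eq_mul_log_two_add {y : ℝ} (hy : 0 < y) (k : ℕ) :
    Real.log y = k * Real.log 2 + Real.log (y / 2 ^ k) := by
  rw [Real.log_div hy.ne' (by positivity), Real.log_pow]
  ring

end LogCert

end Literature.Barriers.MatrixMultiplication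

end
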